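import Summits.BirchSwinnertonDyer.BirchSwinnertonDyer.Theorems.KolyvaginRoadThreeSchneiderTamAtThreeHeightLogNumeratorLargePrimeSeries
import Literature.NumberTheory.EllipticCurves.MordellCurveThreeDescentLocalRat
import HarnessLib

/-!
# «The height is the logarithm of the numerator» — the EXACT second-order law at EVERY multiplicative
# prime `p ≥ 5`, part 2a: the polynomial core of `x = ℘(ℓ) − b₂/12` to fourth order at level ONE

HONEST FRAMING (cell `bsd-stepL`, seat `bsd-stepL-tam3-p2` g5, WIDTH-LEVER second lane «closed-form Schneider
local factor … by Kodaira type (finite case table proved once)»; `--supports stmt-BirchSwinnertonDyer-19154 --as helper`):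
THEOREMS ONLY, unconditional, route-independent (no Theses import); 0 definitions, 0 named facts, 0 sorry;
nothing here proves the crux `SchneiderTamAtThree`, Schneider's conjecture or BSD. `p ≥ 5` twin of the `p = 3`
part 2a (`…DeepWeierstrassPCore`, g2): there the formal logarithm was truncated at its cubic term and the
identity's `z⁴`-coefficient was `G₄ = (−2a₁⁴ − 6a₁²a₂ − 2a₂² − 7a₁a₃ + a₄)/5`, harmless at `p = 3`; at `p = 5` that
`1/5` is fatal, and it is cancelled EXACTLY by the quintic coefficient `(a₁⁴+3a₁²a₂+a₂²+6a₁a₃+2a₄)/5` of `log_W`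
(part 1a): with `S = log_W(z)/z` truncated at `z⁴`,
`(1 − a₁z − a₂z² − a₃z³)·S² − 1 + (b₂/12)z²S² − (c₄/240)z⁴ = Σ_{j=4}^{11} (N_j/D_j) zʲ` with `N_j ∈ ℤ[a₁,…,a₄]`,
`N₄/D₄ = a₁a₃ + a₄` and `D_j ∈ {120, 1080, 720, 14400, 1200, 300, 25}` — `v₅(D_j) ≤ 1` for `j ≤ 7` and `≤ 2` for
`j ≤ 11`, so `‖Σ‖ ≤ ‖z‖⁴` as soon as `p‖z‖ ≤ 1` (level one).

* `norm_inv_smooth_le_padic` — `‖(2ᵃ3ᵇ5ᶜ)⁻¹‖_p ≤ pᶜ` for `p ≥ 5` (numerals of `ℤ_p` in `ℚ_p` via the tree's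
  `MordellDescent.padicInt_coe_ofNat`);
* `norm_weierstrassP_poly_le_padic` — the identity and the bound `‖…‖ ≤ ‖z‖⁴` for `a_i ∈ ℤ_p`, `‖z‖ ≤ p⁻¹`.

References: [SilvermanAEC2009] IV.1, VI.3 (the `℘`-expansion); tree: g2 `…DeepWeierstrassPCore` (`p = 3`).
-/

noncomputable section

open scoped Classical
open IsUltrametricDist
open Literature.NumberTheory.EllipticCurves

namespace Summit.BirchSwinnertonDyer.Rank1Residual.X11b.RegMult.HeightLogNumerator

variable {p : ℕ} [hp : Fact p.Prime]

/-! ### §7 The constants `1/(2ᵃ3ᵇ5ᶜ)` at `p ≥ 5` -/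

/-- **`‖(2ᵃ·3ᵇ·5ᶜ)⁻¹‖_p ≤ pᶜ` for `p ≥ 5`** (`2, 3` are units; `‖5‖_p ≥ p⁻¹` with equality iff `p = 5`). [folklore] -/
theorem norm_inv_smooth_le_padic (hp5 : 5 ≤ p) (a b c : ℕ) :
    ‖(((2 ^ a * 3 ^ b * 5 ^ c : ℕ) : ℚ_[p]))⁻¹‖ ≤ (p : ℝ) ^ c := by
  have hp2 : p ≠ 2 := by omega
  have hp3 : p ≠ 3 := by omega
  have hp1 : (1 : ℝ) ≤ p := by exact_mod_cast hp.out.one_lt.le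
  have hp0 : (0 : ℝ) < p := by positivity
  have hcop2 : Nat.Coprime p 2 := (Nat.coprime_primes hp.out Nat.prime_two).mpr hp2
  have hcop3 : Nat.Coprime p 3 := (Nat.coprime_primes hp.out Nat.prime_three).mpr hp3
  have h23 : ‖((2 ^ a * 3 ^ b : ℕ) : ℚ_[p])‖ = 1 :=
    Padic.norm_natCast_eq_one_iff.mpr ((Nat.Coprime.pow_right a hcop2).mul_right (Nat.Coprime.pow_right b hcop3))
  have h5 : (p : ℝ)⁻¹ ≤ ‖((5 : ℕ) : ℚ_[p])‖ := by
    rcases eq_or_ne p 5 with h | h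
    · subst h; rw [Padic.norm_p]
    · rw [Padic.norm_natCast_eq_one_iff.mpr ((Nat.coprime_primes hp.out (by norm_num)).mpr h)]
      exact inv_le_one_of_one_le₀ hp1
  have h50 : 0 < ‖((5 : ℕ) : ℚ_[p])‖ := lt_of_lt_of_le (inv_pos.mpr hp0) h5
  rw [Nat.cast_mul, mul_inv, norm_mul, norm_inv, h23, inv_one, one_mul, Nat.cast_pow, norm_inv, norm_pow,
    ← inv_pow]
  exact pow_le_pow_left₀ (by positivity) ((inv_le_comm₀ h50 hp0).mpr h5) c

/-! ### §8 The polynomial identity behind `x·ℓ² = 1 − (b₂/12)ℓ² + (c₄/240)ℓ⁴ + O(‖x‖⁻²)` and its bound -/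

set_option maxHeartbeats 400000 in
/-- **The polynomial core of `x = ℘(ℓ) − b₂/12` to fourth order at level one, `p ≥ 5`.** For `a₁, …, a₄ ∈ ℤ_p`,
`‖z‖_p ≤ p⁻¹`, `Q = 1 − a₁z − a₂z² − a₃z³` and
`S = 1 + ½a₁z + ⅓(a₁²+a₂)z² + ¼(a₁³+2a₁a₂+2a₃)z³ + ⅕(a₁⁴+3a₁²a₂+a₂²+6a₁a₃+2a₄)z⁴` (`= log_W(z)/z` to `O(z⁵)`):
**`‖Q·S² − 1 + (b₂/12)·z²S² − (c₄/240)·z⁴‖_p ≤ ‖z‖_p⁴`**, `b₂ = a₁² + 4a₂`, `c₄ = b₂² − 24(2a₄ + a₁a₃)`. The left side is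
EXACTLY `Σ_{j=4}^{11} (N_j/D_j) zʲ` with integer polynomials `N_j` and `D_j = 1, 120, 1080, 720, 14400, 1200, 300, 25`
(`‖D_j⁻¹‖ ≤ p` for `j ≤ 7`, `≤ p²` for `j ≤ 11`, and `p‖z‖ ≤ 1`). [cite: SilvermanAEC2009, IV.1, VI.3] -/
theorem norm_weierstrassP_poly_le_padic (hp5 : 5 ≤ p) (a₁ a₂ a₃ a₄ : ℤ_[p]) {z S Q : ℚ_[p]}
    (hz : ‖z‖ ≤ (p : ℝ)⁻¹) (hQ : Q = 1 - (a₁ : ℚ_[p]) * z - (a₂ : ℚ_[p]) * z ^ 2 - (a₃ : ℚ_[p]) * z ^ 3)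
    (hS : S = 1 + (2 : ℚ_[p])⁻¹ * (a₁ : ℚ_[p]) * z + (3 : ℚ_[p])⁻¹ * ((a₁ : ℚ_[p]) ^ 2 + a₂) * z ^ 2 +
        (4 : ℚ_[p])⁻¹ * ((a₁ : ℚ_[p]) ^ 3 + 2 * a₁ * a₂ + 2 * a₃) * z ^ 3 +
        (5 : ℚ_[p])⁻¹ * ((a₁ : ℚ_[p]) ^ 4 + 3 * (a₁ : ℚ_[p]) ^ 2 * a₂ + (a₂ : ℚ_[p]) ^ 2 + 6 * a₁ * a₃ + 2 * a₄) *
          z ^ 4) :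
    ‖Q * S ^ 2 - 1 + ((a₁ : ℚ_[p]) ^ 2 + 4 * a₂) / 12 * z ^ 2 * S ^ 2 -
        (((a₁ : ℚ_[p]) ^ 2 + 4 * a₂) ^ 2 - 24 * (2 * (a₄ : ℚ_[p]) + a₁ * a₃)) / 240 * z ^ 4‖ ≤ ‖z‖ ^ 4 := by
  have hp1 : (1 : ℝ) ≤ p := by exact_mod_cast hp.out.one_lt.le
  have hp0 : (0 : ℝ) < p := by positivity
  -- the integer polynomials `N_j`
  set N₄ : ℤ_[p] := a₁ * a₃ + a₄ with hN₄
  set N₅ : ℤ_[p] := (-39) * a₁ ^ 5 + (-152) * a₁ ^ 3 * a₂ + (-104) * a₁ * a₂ ^ 2 + (-264) * a₁ ^ 2 * a₃ +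
    (-120) * a₂ * a₃ + (-48) * a₁ * a₄ with hN₅
  set N₆ : ℤ_[p] := (-116) * a₁ ^ 6 + (-717) * a₁ ^ 4 * a₂ + (-1068) * a₁ ^ 2 * a₂ ^ 2 + (-1161) * a₁ ^ 3 * a₃ +
    (-224) * a₂ ^ 3 + (-2484) * a₁ * a₂ * a₃ + (-72) * a₁ ^ 2 * a₄ + (-810) * a₃ ^ 2 + (-288) * a₂ * a₄ with hN₆
  set N₇ : ℤ_[p] := (-47) * a₁ ^ 7 + (-314) * a₁ ^ 5 * a₂ + (-556) * a₁ ^ 3 * a₂ ^ 2 + (-636) * a₁ ^ 4 * a₃ +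
    (-208) * a₁ * a₂ ^ 3 + (-1740) * a₁ ^ 2 * a₂ * a₃ + (-24) * a₁ ^ 3 * a₄ + (-384) * a₂ ^ 2 * a₃ +
    (-1404) * a₁ * a₃ ^ 2 + (-96) * a₁ * a₂ * a₄ + (-288) * a₃ * a₄ with hN₇
  set N₈ : ℤ_[p] := (-629) * a₁ ^ 8 + (-4684) * a₁ ^ 6 * a₂ + (-10324) * a₁ ^ 4 * a₂ ^ 2 + (-8628) * a₁ ^ 5 * a₃ +
    (-6784) * a₁ ^ 2 * a₂ ^ 3 + (-29544) * a₁ ^ 3 * a₂ * a₃ + (-256) * a₁ ^ 4 * a₄ + (-704) * a₂ ^ 4 +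
    (-16128) * a₁ * a₂ ^ 2 * a₃ + (-18324) * a₁ ^ 2 * a₃ ^ 2 + (-1088) * a₁ ^ 2 * a₂ * a₄ + (-7200) * a₂ * a₃ ^ 2 +
    (-256) * a₂ ^ 2 * a₄ + 2304 * a₁ * a₃ * a₄ + 2304 * a₄ ^ 2 with hN₈
  set N₉ : ℤ_[p] := (-38) * a₁ ^ 9 + (-318) * a₁ ^ 7 * a₂ + (-858) * a₁ ^ 5 * a₂ ^ 2 + (-731) * a₁ ^ 6 * a₃ +
    (-828) * a₁ ^ 3 * a₂ ^ 3 + (-3128) * a₁ ^ 4 * a₂ * a₃ + (-172) * a₁ ^ 5 * a₄ + (-208) * a₁ * a₂ ^ 4 +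
    (-2936) * a₁ ^ 2 * a₂ ^ 2 * a₃ + (-2868) * a₁ ^ 3 * a₃ ^ 2 + (-696) * a₁ ^ 3 * a₂ * a₄ + (-320) * a₂ ^ 3 * a₃ +
    (-2520) * a₁ * a₂ * a₃ ^ 2 + (-512) * a₁ * a₂ ^ 2 * a₄ + (-1432) * a₁ ^ 2 * a₃ * a₄ + (-300) * a₃ ^ 3 +
    (-640) * a₂ * a₃ * a₄ + (-192) * a₁ * a₄ ^ 2 with hN₉
  set N₁₀ : ℤ_[p] := a₁ ^ 10 + (-2) * a₁ ^ 8 * a₂ + (-37) * a₁ ^ 6 * a₂ ^ 2 + (-18) * a₁ ^ 7 * a₃ +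
    (-82) * a₁ ^ 4 * a₂ ^ 3 + (-210) * a₁ ^ 5 * a₂ * a₃ + 4 * a₁ ^ 6 * a₄ + (-47) * a₁ ^ 2 * a₂ ^ 4 +
    (-486) * a₁ ^ 3 * a₂ ^ 2 * a₃ + (-204) * a₁ ^ 4 * a₃ ^ 2 + (-20) * a₁ ^ 4 * a₂ * a₄ + (-8) * a₂ ^ 5 +
    (-156) * a₁ * a₂ ^ 3 * a₃ + (-828) * a₁ ^ 2 * a₂ * a₃ ^ 2 + (-92) * a₁ ^ 2 * a₂ ^ 2 * a₄ + (-36) * a₁ ^ 3 * a₃ * a₄ +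
    (-60) * a₂ ^ 2 * a₃ ^ 2 + (-32) * a₂ ^ 3 * a₄ + (-360) * a₁ * a₃ ^ 3 + (-312) * a₁ * a₂ * a₃ * a₄ +
    4 * a₁ ^ 2 * a₄ ^ 2 + (-120) * a₃ ^ 2 * a₄ + (-32) * a₂ * a₄ ^ 2 with hN₁₀
  set N₁₁ : ℤ_[p] := (-1) * a₁ ^ 8 * a₃ + (-6) * a₁ ^ 6 * a₂ * a₃ + (-11) * a₁ ^ 4 * a₂ ^ 2 * a₃ +
    (-12) * a₁ ^ 5 * a₃ ^ 2 + (-6) * a₁ ^ 2 * a₂ ^ 3 * a₃ + (-36) * a₁ ^ 3 * a₂ * a₃ ^ 2 + (-4) * a₁ ^ 4 * a₃ * a₄ +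
    (-1) * a₂ ^ 4 * a₃ + (-12) * a₁ * a₂ ^ 2 * a₃ ^ 2 + (-36) * a₁ ^ 2 * a₃ ^ 3 + (-12) * a₁ ^ 2 * a₂ * a₃ * a₄ +
    (-4) * a₂ ^ 2 * a₃ * a₄ + (-24) * a₁ * a₃ ^ 2 * a₄ + (-4) * a₃ * a₄ ^ 2 with hN₁₁
  -- the exact identity
  have hid : Q * S ^ 2 - 1 + ((a₁ : ℚ_[p]) ^ 2 + 4 * a₂) / 12 * z ^ 2 * S ^ 2 -
      (((a₁ : ℚ_[p]) ^ 2 + 4 * a₂) ^ 2 - 24 * (2 * (a₄ : ℚ_[p]) + a₁ * a₃)) / 240 * z ^ 4 =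
      z ^ 4 * ((N₄ : ℚ_[p]) + (120 : ℚ_[p])⁻¹ * (N₅ : ℚ_[p]) * z + (1080 : ℚ_[p])⁻¹ * (N₆ : ℚ_[p]) * z ^ 2 +
        (720 : ℚ_[p])⁻¹ * (N₇ : ℚ_[p]) * z ^ 3 + (14400 : ℚ_[p])⁻¹ * (N₈ : ℚ_[p]) * z ^ 4 +
        (1200 : ℚ_[p])⁻¹ * (N₉ : ℚ_[p]) * z ^ 5 + (300 : ℚ_[p])⁻¹ * (N₁₀ : ℚ_[p]) * z ^ 6 +
        (25 : ℚ_[p])⁻¹ * (N₁₁ : ℚ_[p]) * z ^ 7) := by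
    rw [hQ, hS, hN₄, hN₅, hN₆, hN₇, hN₈, hN₉, hN₁₀, hN₁₁]
    push_cast [MordellDescent.padicInt_coe_ofNat]
    ring
  rw [hid, norm_mul, norm_pow]
  -- the bound: every summand of the bracket has norm `≤ 1`
  have hN : ∀ N : ℤ_[p], ‖(N : ℚ_[p])‖ ≤ 1 := fun N => PadicInt.norm_le_one N
  have hz0 : 0 ≤ ‖z‖ := norm_nonneg z
  have hpz : (p : ℝ) * ‖z‖ ≤ 1 := by
    calc (p : ℝ) * ‖z‖ ≤ p * (p : ℝ)⁻¹ := by gcongr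
      _ = 1 := mul_inv_cancel₀ hp0.ne'
  have hz1 : ‖z‖ ≤ 1 := hz.trans (inv_le_one_of_one_le₀ hp1)
  have hpzn : ∀ n : ℕ, (p : ℝ) * ‖z‖ ^ (n + 1) ≤ 1 := fun n => by
    calc (p : ℝ) * ‖z‖ ^ (n + 1) = ((p : ℝ) * ‖z‖) * ‖z‖ ^ n := by ring
      _ ≤ 1 * 1 := mul_le_mul hpz (pow_le_one₀ hz0 hz1) (by positivity) zero_le_one
      _ = 1 := one_mul _
  have hp2zn : ∀ n : ℕ, (p : ℝ) ^ 2 * ‖z‖ ^ (n + 2) ≤ 1 := fun n => by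
    calc (p : ℝ) ^ 2 * ‖z‖ ^ (n + 2) = ((p : ℝ) * ‖z‖) ^ 2 * ‖z‖ ^ n := by ring
      _ ≤ 1 * 1 := mul_le_mul (pow_le_one₀ (by positivity) hpz) (pow_le_one₀ hz0 hz1) (by positivity) zero_le_one
      _ = 1 := one_mul _
  have h120 : ‖(120 : ℚ_[p])⁻¹‖ ≤ p := by
    have h := norm_inv_smooth_le_padic hp5 3 1 1; norm_num at h; rw [norm_inv]; exact h
  have h1080 : ‖(1080 : ℚ_[p])⁻¹‖ ≤ p := by
    have h := norm_inv_smooth_le_padic hp5 3 3 1; norm_num at h; rw [norm_inv]; exact h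
  have h720 : ‖(720 : ℚ_[p])⁻¹‖ ≤ p := by
    have h := norm_inv_smooth_le_padic hp5 4 2 1; norm_num at h; rw [norm_inv]; exact h
  have h14400 : ‖(14400 : ℚ_[p])⁻¹‖ ≤ (p : ℝ) ^ 2 := by
    have h := norm_inv_smooth_le_padic hp5 6 2 2; norm_num at h; rw [norm_inv]; exact h
  have h1200 : ‖(1200 : ℚ_[p])⁻¹‖ ≤ (p : ℝ) ^ 2 := by
    have h := norm_inv_smooth_le_padic hp5 4 1 2; norm_num at h; rw [norm_inv]; exact h
  have h300 : ‖(300 : ℚ_[p])⁻¹‖ ≤ (p : ℝ) ^ 2 := by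
    have h := norm_inv_smooth_le_padic hp5 2 1 2; norm_num at h; rw [norm_inv]; exact h
  have h25 : ‖(25 : ℚ_[p])⁻¹‖ ≤ (p : ℝ) ^ 2 := by
    have h := norm_inv_smooth_le_padic hp5 0 0 2; norm_num at h; rw [norm_inv]; exact h
  -- a summand `D⁻¹ N zⁿ` with `‖D⁻¹‖ ≤ p`, `n ≥ 1`, or `‖D⁻¹‖ ≤ p²`, `n ≥ 2`, has norm `≤ 1`
  have term1 : ∀ (D : ℚ_[p]) (N : ℤ_[p]) (n : ℕ), ‖D‖ ≤ p → ‖D * (N : ℚ_[p]) * z ^ (n + 1)‖ ≤ 1 :=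
    fun D N n hD => by
      rw [norm_mul, norm_mul, norm_pow]
      calc ‖D‖ * ‖(N : ℚ_[p])‖ * ‖z‖ ^ (n + 1) ≤ p * 1 * ‖z‖ ^ (n + 1) := by gcongr; exact hN N
        _ = (p : ℝ) * ‖z‖ ^ (n + 1) := by ring
        _ ≤ 1 := hpzn n
  have term2 : ∀ (D : ℚ_[p]) (N : ℤ_[p]) (n : ℕ), ‖D‖ ≤ (p : ℝ) ^ 2 → ‖D * (N : ℚ_[p]) * z ^ (n + 2)‖ ≤ 1 :=
    fun D N n hD => by
      rw [norm_mul, norm_mul, norm_pow]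
      calc ‖D‖ * ‖(N : ℚ_[p])‖ * ‖z‖ ^ (n + 2) ≤ (p : ℝ) ^ 2 * 1 * ‖z‖ ^ (n + 2) := by gcongr; exact hN N
        _ = (p : ℝ) ^ 2 * ‖z‖ ^ (n + 2) := by ring
        _ ≤ 1 := hp2zn n
  have hbr : ‖(N₄ : ℚ_[p]) + (120 : ℚ_[p])⁻¹ * (N₅ : ℚ_[p]) * z + (1080 : ℚ_[p])⁻¹ * (N₆ : ℚ_[p]) * z ^ 2 +
        (720 : ℚ_[p])⁻¹ * (N₇ : ℚ_[p]) * z ^ 3 + (14400 : ℚ_[p])⁻¹ * (N₈ : ℚ_[p]) * z ^ 4 +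
        (1200 : ℚ_[p])⁻¹ * (N₉ : ℚ_[p]) * z ^ 5 + (300 : ℚ_[p])⁻¹ * (N₁₀ : ℚ_[p]) * z ^ 6 +
        (25 : ℚ_[p])⁻¹ * (N₁₁ : ℚ_[p]) * z ^ 7‖ ≤ 1 := by
    refine (norm_add_le_max _ _).trans (max_le ((norm_add_le_max _ _).trans (max_le
      ((norm_add_le_max _ _).trans (max_le ((norm_add_le_max _ _).trans (max_le
      ((norm_add_le_max _ _).trans (max_le ((norm_add_le_max _ _).trans (max_le
      ((norm_add_le_max _ _).trans (max_le (hN N₄) ?_)) ?_)) ?_)) ?_)) ?_)) ?_)) ?_)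
    · have h := term1 _ N₅ 0 h120; rwa [zero_add, pow_one] at h
    · exact term1 _ N₆ 1 h1080
    · exact term1 _ N₇ 2 h720
    · exact term2 _ N₈ 2 h14400
    · exact term2 _ N₉ 3 h1200
    · exact term2 _ N₁₀ 4 h300
    · exact term2 _ N₁₁ 5 h25
  calc ‖z‖ ^ 4 * _ ≤ ‖z‖ ^ 4 * 1 := by gcongr
    _ = ‖z‖ ^ 4 := mul_one _

end Summit.BirchSwinnertonDyer.Rank1Residual.X11b.RegMult.HeightLogNumerator

end
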